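import Mathlib
import Summits.KontsevichZagierPeriods.Zeta5Search.Elimination.HalfShiftRaiseCore
import HarnessLib

/-!
# ζ(5) search — class `elim`: THE HALF-SHIFT RAISE `pr·D(Hz) = Θ₁D(z) + Θ₂D(z+e₇) + Θ₃D(z+2e₇)` (E-L19b, part 2 of 2;
# cell `pub-zeta5`, fam-elim gen 23; second half of gen-1's E-L19 ask of 2026-08-21, the cluster `{c, c + e₇, Hc, DSc}`)

HONEST FRAMING: systematic search; no irrationality claim unless certified.

OUR work (Summit side; `families/elim/FAMILY.md` §6 (E-L19b)).  `dictRaise_at`: for a b-chart point `z` with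
`d(z) ≥ 1` and `z₇ + 1 ≤ z₀`, the canonical coefficient vectors `D = (U, W, V) ∈ ℚ³` of `z, z + e₇, z + 2e₇`
(level `z₀`) and of the half-shifted point `Hz = (z₀ + 1; z + 1_{{4,5,7}})` satisfy, coordinatewise,
   `Θ₁·D(z) + Θ₂·D(z + e₇) + Θ₃·D(z + 2e₇) − pr·D(Hz) = 0`
with the closed forms of part 1 (`raiseTh1 = meetA·q(−z₇−1)`, `raiseTh2`, `raiseTh3 = d·meetQ`, `raisePr`).
Mechanism: the creative-telescoping identity `Θ₁R_z + Θ₂R_{z+e₇} + Θ₃R_{z+2e₇} − pr·R_{Hz} = G(t+1) − G(t)`,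
`G(t) = g(t+1)/((t+1)_{z₀+1})⁶`, `g(x) = (x − 1)·∏_{j∈T}(x + z₀ − z_j)·q(x − 1)·S_z(x)` (`raiseG`; the meet's
telescoper had `q ≡ −1`), proved as a polynomial identity (`hrel`: `raise_core` of part 1 combined with the two
Pochhammer identities `eval_numPoly_hShift_mul`, `slotEval_shift_mul` of `HalfShift` and the cancellation of
`∏_{j∉T}(X + z₀ + 1 − z_j) ≠ 0`), then the `1 + 3` mixed-level summability principle
`coeff_rel_of_summable_mixed13` (one point at level `z₀ + 1`, three padded points at level `z₀`; sibling of
`coeff_rel_of_summable_mixed`); the `V`-boundary term vanishes because `(X − 1) ∣ g`; `deg g ≤ 6 + 2Σ_j z_j < 6(z₀+1)`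
is where `d(z) ≥ 1` is used.
Consequences for the successor (E-L19c, not in this file; `HOME/pub-zeta5-fam-elim/g23/E19-DESIGN.md` §4–§6): with
`cas3` (`WedgeDictionaryRankThree`) RAISE3 gives the mixed Casoratians `pr·det(D(z), D(z+e₇), D(Hz)) = d·Q·cas3(z)` and,
with the meet, `Q·pr·det(D(z), D(Hz), D(Hz+e₇)) = −D₀·d·Q·cas3(z)`; gen-1's four-term BRIDGE among the eliminant wedges
`C(z), C(z+e₇), C(Hz), C(DSz)` then follows by three Cramer pairings (numerically == gen-1's `d_c, d₇, d_X, d_DS` at 8/8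
points, `e19/probe27.out`; not a theorem here).
What this is NOT: anything about sizes, denominators, valuations or irrationality; the class verdict is unchanged
(T1 NO / T2 NO / T4 YES).
-/

open Finset Polynomial

namespace Summit.KontsevichZagierPeriods.Zeta5Search.Elimination

open Summit.KontsevichZagierPeriods.Zeta5Search.DualSeries (InBox numPoly eval_numPoly numPoly_update)
open Summit.KontsevichZagierPeriods.Zeta5Search.WedgeDictionary
open Literature.NumberTheory.Transcendental
open Literature.NumberTheory.Transcendental.BallRivoal (pfEval pf_unique poch_pos harm pochPoly eval_pochPoly)

/-! ### Summable combinations at two adjacent levels, `1 + 3` form -/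

/-- **Coefficient relations of a summable combination at two adjacent levels, `1 + 3` form** (sibling of
`coeff_rel_of_summable_mixed`).  Point `b₀` at level `N + 1` and `b₁, b₂, b₃` at level `N` (in the box, admissible
slot sums); the level-`N` numerators are padded by `(X + N + 1)⁶`.  If
`c₀·numPoly b₀ + (c₁·numPoly b₁ + c₂·numPoly b₂ + c₃·numPoly b₃)·(X+N+1)⁶ = g(X+1)X⁶ − g·(X+N+1)⁶` with
`deg g < 6(N+1)`, then `Σ cᵢ U(bᵢ) = Σ cᵢ W(bᵢ) = 0` and `Σ cᵢ V(bᵢ) = g(1)/((1)_{N+1})⁶`. -/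
theorem coeff_rel_of_summable_mixed13 (b₀ b₁ b₂ b₃ : ℕ → ℤ) (N : ℕ)
    (h₀ : InBox b₀) (h₁ : InBox b₁) (h₂ : InBox b₂) (h₃ : InBox b₃)
    (hs₀ : ∑ j ∈ range 7, b₀ (j + 1) ≤ 3 * b₀ 0 + 1) (hs₁ : ∑ j ∈ range 7, b₁ (j + 1) ≤ 3 * b₁ 0 + 1)
    (hs₂ : ∑ j ∈ range 7, b₂ (j + 1) ≤ 3 * b₂ 0 + 1) (hs₃ : ∑ j ∈ range 7, b₃ (j + 1) ≤ 3 * b₃ 0 + 1)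
    (hN₀ : (b₀ 0).toNat = N + 1) (hN₁ : (b₁ 0).toNat = N) (hN₂ : (b₂ 0).toNat = N) (hN₃ : (b₃ 0).toNat = N)
    (c₀ c₁ c₂ c₃ : ℚ) (g : ℚ[X]) (hg : g.natDegree + 1 ≤ 6 * (N + 1))
    (hrel : C c₀ * numPoly b₀ + C c₁ * (numPoly b₁ * (X + C ((N + 1 : ℕ) : ℚ)) ^ 6) +
        C c₂ * (numPoly b₂ * (X + C ((N + 1 : ℕ) : ℚ)) ^ 6) + C c₃ * (numPoly b₃ * (X + C ((N + 1 : ℕ) : ℚ)) ^ 6) =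
      g.comp (X + C 1) * X ^ 6 - g * (X + C ((N + 1 : ℕ) : ℚ)) ^ 6) :
    (c₀ * coeffU b₀ + c₁ * coeffU b₁ + c₂ * coeffU b₂ + c₃ * coeffU b₃ = 0 ∧
      c₀ * coeffW b₀ + c₁ * coeffW b₁ + c₂ * coeffW b₂ + c₃ * coeffW b₃ = 0) ∧
      c₀ * coeffV b₀ + c₁ * coeffV b₁ + c₂ * coeffV b₂ + c₃ * coeffV b₃ =
        g.eval 1 / BallRivoal.poch 1 (N + 1) ^ 6 := by
  obtain ⟨d₀, hd₀⟩ := exists_isPFData b₀ h₀ hs₀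
  obtain ⟨d₁, hd₁⟩ := exists_isPFData b₁ h₁ hs₁
  obtain ⟨d₂, hd₂⟩ := exists_isPFData b₂ h₂ hs₂
  obtain ⟨d₃, hd₃⟩ := exists_isPFData b₃ h₃ hs₃
  obtain ⟨γ, hγ⟩ := exists_pf_summable (N := N + 1) (by omega) hg
  have hγ' : ∀ t : ℚ, (∀ p, p ≤ N → t + p + 1 ≠ 0) →
      pfEval N 6 γ t = (g.comp (X + C 1)).eval t / BallRivoal.poch (t + 1) (N + 1) ^ 6 := by
    intro t ht
    have h := hγ t (by simpa using ht)
    simpa using h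
  set e : ℕ → ℕ → ℚ := fun o p =>
    c₀ * d₀ o p + c₁ * padData N d₁ o p + c₂ * padData N d₂ o p + c₃ * padData N d₃ o p + padData N γ o p - shiftUp γ o p
    with he
  -- (1) the corrected data evaluate to zero at every natural point
  have he0 : ∀ t : ℕ, pfEval (N + 1) 6 e t = 0 := by
    intro t
    have hu : (t : ℚ) + 1 + ((N + 1 : ℕ) : ℚ) ≠ 0 := by positivity
    have E0 := hd₀ t (fun p _ => by positivity)
    have E1 := hd₁ t (fun p _ => by positivity)
    have E2 := hd₂ t (fun p _ => by positivity)
    have E3 := hd₃ t (fun p _ => by positivity)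
    rw [hN₀, poch_succ_right] at E0
    rw [hN₁] at E1
    rw [hN₂] at E2
    rw [hN₃] at E3
    have E1' := (pfEval_padData (Nat.le_add_right N 1) 6 d₁ (t : ℚ)).trans (E1.trans (pad_frac _ _ _ hu))
    have E2' := (pfEval_padData (Nat.le_add_right N 1) 6 d₂ (t : ℚ)).trans (E2.trans (pad_frac _ _ _ hu))
    have E3' := (pfEval_padData (Nat.le_add_right N 1) 6 d₃ (t : ℚ)).trans (E3.trans (pad_frac _ _ _ hu))
    have Esh : pfEval (N + 1) 6 (shiftUp γ) t = pfEval N 6 γ ((t : ℚ) + 1) := pfEval_shiftUp N 6 γ t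
    have Epad : pfEval (N + 1) 6 (padData N γ) t = pfEval N 6 γ t := pfEval_padData (Nat.le_add_right N 1) _ _ _
    have Etel := telescope_eval (N := N + 1) (by omega) hrel hγ t
    rw [poch_succ_right] at Etel
    simp only [Nat.add_sub_cancel] at Etel
    rw [he, pfEval_comb4V, E0, E1', E2', E3', Esh, Epad]
    simp only [eval_comp, eval_add, eval_mul, eval_pow, eval_C, eval_X] at Etel ⊢
    linear_combination Etel
  -- (2) `e` vanishes identically (uniqueness of partial fractions)
  have hpt : ∀ o p, o < 6 → p ≤ N + 1 → e o p = 0 := pf_unique (N + 1) 6 e 0 (fun t _ => he0 t)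
  -- (3) order-`o` coefficient sums
  have hsum : ∀ {o : ℕ}, o < 6 →
      c₀ * ∑ p ∈ range (N + 2), d₀ o p + c₁ * ∑ p ∈ range (N + 1), d₁ o p +
        c₂ * ∑ p ∈ range (N + 1), d₂ o p + c₃ * ∑ p ∈ range (N + 1), d₃ o p = 0 := by
    intro o ho
    have hz : ∑ p ∈ range (N + 2), e o p = 0 :=
      sum_eq_zero fun p hp => hpt o p ho (by have := mem_range.1 hp; omega)
    have htel : ∑ p ∈ range (N + 2), (padData N γ o p - shiftUp γ o p) = 0 := by
      rw [sum_sub_distrib, sum_shiftUp, sum_padData (Nat.le_add_right N 1), sub_self]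
    have hp1 : ∑ p ∈ range (N + 2), padData N d₁ o p = ∑ p ∈ range (N + 1), d₁ o p := sum_padData (Nat.le_add_right N 1) _ _
    have hp2 : ∑ p ∈ range (N + 2), padData N d₂ o p = ∑ p ∈ range (N + 1), d₂ o p := sum_padData (Nat.le_add_right N 1) _ _
    have hp3 : ∑ p ∈ range (N + 2), padData N d₃ o p = ∑ p ∈ range (N + 1), d₃ o p := sum_padData (Nat.le_add_right N 1) _ _
    have hexp : ∑ p ∈ range (N + 2), e o p =
        c₀ * ∑ p ∈ range (N + 2), d₀ o p + c₁ * ∑ p ∈ range (N + 2), padData N d₁ o p +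
          c₂ * ∑ p ∈ range (N + 2), padData N d₂ o p + c₃ * ∑ p ∈ range (N + 2), padData N d₃ o p +
          ∑ p ∈ range (N + 2), (padData N γ o p - shiftUp γ o p) := by
      simp only [he, sum_add_distrib, sum_sub_distrib, mul_sum]
      ring
    rw [hexp, htel, hp1, hp2, hp3, add_zero] at hz
    exact hz
  refine ⟨⟨?_, ?_⟩, ?_⟩
  · have h := hsum (show 4 < 6 by norm_num)
    rw [coeffU_eq hd₀, coeffU_eq hd₁, coeffU_eq hd₂, coeffU_eq hd₃, hN₀, hN₁, hN₂, hN₃]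
    exact h
  · have h := hsum (show 2 < 6 by norm_num)
    rw [coeffW_eq hd₀, coeffW_eq hd₁, coeffW_eq hd₂, coeffW_eq hd₃, hN₀, hN₁, hN₂, hN₃]
    exact h
  -- (4) the constant terms: Abel summation leaves the boundary term `G(0) = g(1)/((1)_{N+1})⁶`
  have hV : c₀ * coeffV b₀ + c₁ * coeffV b₁ + c₂ * coeffV b₂ + c₃ * coeffV b₃ =
      ∑ o ∈ range 6, ∑ p ∈ range (N + 2), (shiftUp γ o p - padData N γ o p) * harm (o + 1) p := by
    rw [coeffV_eq hd₀, coeffV_eq hd₁, coeffV_eq hd₂, coeffV_eq hd₃, hN₀, hN₁, hN₂, hN₃]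
    have hp1 : ∀ o, ∑ p ∈ range (N + 1), d₁ o p * harm (o + 1) p =
        ∑ p ∈ range (N + 2), padData N d₁ o p * harm (o + 1) p := fun o => (sum_padData_mul N d₁ o _).symm
    have hp2 : ∀ o, ∑ p ∈ range (N + 1), d₂ o p * harm (o + 1) p =
        ∑ p ∈ range (N + 2), padData N d₂ o p * harm (o + 1) p := fun o => (sum_padData_mul N d₂ o _).symm
    have hp3 : ∀ o, ∑ p ∈ range (N + 1), d₃ o p * harm (o + 1) p =
        ∑ p ∈ range (N + 2), padData N d₃ o p * harm (o + 1) p := fun o => (sum_padData_mul N d₃ o _).symm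
    simp only [hp1, hp2, hp3, mul_sum, ← sum_add_distrib]
    refine sum_congr rfl fun o ho => sum_congr rfl fun p hp => ?_
    have h0 := hpt o p (mem_range.1 ho) (by have := mem_range.1 hp; omega)
    simp only [he] at h0
    linear_combination (harm (o + 1) p) * h0
  have hrow : ∀ o, ∑ p ∈ range (N + 2), (shiftUp γ o p - padData N γ o p) * harm (o + 1) p =
      ∑ p ∈ range (N + 1), γ o p * (1 / ((p : ℚ) + 1) ^ (o + 1)) := by
    intro o
    simp only [sub_mul, sum_sub_distrib]
    rw [sum_shiftUp_mul, sum_padData_mul, ← sum_sub_distrib]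
    refine sum_congr rfl fun p _ => ?_
    rw [SymRay.harm_succ]
    ring
  have hpf : pfEval N 6 γ 0 = ∑ o ∈ range 6, ∑ p ∈ range (N + 1), γ o p * (1 / ((p : ℚ) + 1) ^ (o + 1)) := by
    unfold pfEval
    rw [sum_comm]
    refine sum_congr rfl fun o _ => sum_congr rfl fun p _ => ?_
    ring
  have hγ0 := hγ' 0 (fun p _ => by positivity)
  simp only [eval_comp, eval_add, eval_X, eval_C, zero_add] at hγ0
  rw [hV, sum_congr rfl fun o _ => hrow o, ← hpf, hγ0]


/-! ### The telescoper -/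

/-- `q₂, q₁, q₀` at `z`. -/
def raiseQ2 (z : ℕ → ℤ) : ℚ := raiseE1 z - 2 * raiseM z

/-- `q₁ = (e₁ − M)(e₁ − 2M)`. -/
def raiseQ1 (z : ℕ → ℤ) : ℚ := (raiseE1 z - raiseM z) * (raiseE1 z - 2 * raiseM z)

/-- `q₀ = (e₁ − M)e₂ − e₃ − M(e₁ − M)²`. -/
def raiseQ0 (z : ℕ → ℤ) : ℚ := (raiseE1 z - raiseM z) * raiseE2 z - raiseE3 z - raiseM z * (raiseE1 z - raiseM z) ^ 2

/-- `q_z(X − 1)` as a polynomial (an explicit quadratic). -/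
noncomputable def raiseQPoly (z : ℕ → ℤ) : ℚ[X] :=
  C (raiseQ2 z) * X ^ 2 + C (raiseQ1 z - 2 * raiseQ2 z) * X + C (raiseQ2 z - raiseQ1 z + raiseQ0 z)

/-- `q_z(X − 1)` evaluates to `q_z(x − 1)`. -/
theorem eval_raiseQPoly (z : ℕ → ℤ) (x : ℚ) : (raiseQPoly z).eval x = raiseQ z (x - 1) := by
  unfold raiseQPoly raiseQ qForm raiseQ2 raiseQ1 raiseQ0
  simp only [eval_add, eval_mul, eval_pow, eval_C, eval_X]
  ring

/-- The telescoper numerator `g(X) = (X − 1)·∏_{j∈T}(X + z₀ − z_j)·q_z(X − 1)·S_z(X)`: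
RAISE3 is `Σ cᵢ R_{bᵢ}(t) = G(t+1) − G(t)` with `G(t) = g(t+1)/((t+1)_{z₀+1})⁶`. -/
noncomputable def raiseG (z : ℕ → ℤ) : ℚ[X] := (X - C 1) * t3Poly z * raiseQPoly z * slotPoly z

/-- `g(x) = (x − 1)·T₃(x)·q(x − 1)·S_z(x)`. -/
theorem eval_raiseG (z : ℕ → ℤ) (x : ℚ) :
    (raiseG z).eval x = (x - 1) * t3Eval z x * raiseQ z (x - 1) * slotEval z x := by
  unfold raiseG t3Poly t3Eval
  simp only [eval_mul, eval_sub, eval_add, eval_X, eval_C, eval_slotPoly, eval_raiseQPoly]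
  push_cast
  ring

/-- `g(x + 1) = x·T₃(x+1)·q(x)·S_z(x+1)`. -/
theorem eval_raiseG_succ (z : ℕ → ℤ) (x : ℚ) :
    (raiseG z).eval (x + 1) = x * t3Eval z (x + 1) * raiseQ z x * slotEval z (x + 1) := by
  rw [eval_raiseG, add_sub_cancel_right]

/-- `deg g ≤ 6 + 2 Σ_j z_j`. -/
theorem natDegree_raiseG_le (z : ℕ → ℤ) : (raiseG z).natDegree ≤ 6 + ∑ j ∈ range 7, 2 * (z (j + 1)).toNat := by
  unfold raiseG
  have h1 : (X - C (1 : ℚ)).natDegree ≤ 1 := (natDegree_X_sub_C _).le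
  have h3 : (t3Poly z).natDegree ≤ 3 := by
    unfold t3Poly
    refine natDegree_mul_le.trans ?_
    have := natDegree_mul_le (p := X + C ((z 0 - z 4 : ℤ) : ℚ)) (q := X + C ((z 0 - z 5 : ℤ) : ℚ))
    have a := (natDegree_X_add_C ((z 0 - z 4 : ℤ) : ℚ)).le
    have b := (natDegree_X_add_C ((z 0 - z 5 : ℤ) : ℚ)).le
    have c := (natDegree_X_add_C ((z 0 - z 7 : ℤ) : ℚ)).le
    omega
  have hq : (raiseQPoly z).natDegree ≤ 2 := by
    unfold raiseQPoly
    exact natDegree_quadratic_le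
  have hs := natDegree_slotPoly_le z
  have := natDegree_mul_le (p := (X - C (1 : ℚ)) * t3Poly z * raiseQPoly z) (q := slotPoly z)
  have := natDegree_mul_le (p := (X - C (1 : ℚ)) * t3Poly z) (q := raiseQPoly z)
  have := natDegree_mul_le (p := X - C (1 : ℚ)) (q := t3Poly z)
  omega

/-! ### The theorem -/

set_option maxHeartbeats 800000 in
/-- **Dictionary, half-shift raise (E-L19b, RAISE3).**  For an integer point `z` of the b-chart box with
`d(z) ≥ 1` and `z₇ + 1 ≤ z₀`, the canonical coefficients `ω ∈ {U, W, V}` of the three collinear level-`z₀` points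
`z, z + e₇, z + 2e₇` and of the half-shifted point `Hz = (z₀+1; z + 1_{{4,5,7}})` satisfy the explicit relation
`Θ₁·ω(z) + Θ₂·ω(z+e₇) + Θ₃·ω(z+2e₇) − pr·ω(Hz) = 0` with `Θ₁ = A·q(−z₇−1)`, `Θ₂ = raiseTh2`, `Θ₃ = d·Q`,
`pr = ∏_{j<k∈{1,2,3,6}}(z₀+1−z_j−z_k)`: the vector `pr·D(Hz)` expressed in the basis `D(z), D(z+e₇), D(z+2e₇)` of
`ℚ³` (a basis where `cas3(z) ≠ 0`, `rankThreeClosedForm_holds`). -/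
theorem dictRaise_at (z : ℕ → ℤ) (hz : InBox z) (hd : 1 ≤ dOf z) (h7 : z 7 + 1 ≤ z 0) :
    (raiseTh1 z * coeffU z + raiseTh2 z * coeffU (bump z 6) + raiseTh3 z * coeffU (bump (bump z 6) 6) -
          raisePr z * coeffU (hShift z) = 0 ∧
      raiseTh1 z * coeffW z + raiseTh2 z * coeffW (bump z 6) + raiseTh3 z * coeffW (bump (bump z 6) 6) -
          raisePr z * coeffW (hShift z) = 0) ∧
      raiseTh1 z * coeffV z + raiseTh2 z * coeffV (bump z 6) + raiseTh3 z * coeffV (bump (bump z 6) 6) -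
          raisePr z * coeffV (hShift z) = 0 := by
  set N := (z 0).toNat with hN
  have hN0 : ((N : ℕ) : ℤ) = z 0 := by rw [hN]; exact Int.toNat_of_nonneg hz.1
  have hNq : ((N : ℕ) : ℚ) = (z 0 : ℚ) := by exact_mod_cast hN0
  have hz7 : 0 ≤ z 7 := (hz.2 6 (by simp)).1
  have hd0 : 0 ≤ dOf z := by omega
  have h7' : z 7 ≤ z 0 := by omega
  -- the four points are admissible
  obtain ⟨hb7, hs7⟩ := box_update z hz hd0 (show 6 ∈ range 7 by simp) h7'
  have hb77v : bump z 6 7 = z 7 + 1 := bump_self z 6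
  have hd7 : 0 ≤ dOf (bump z 6) := by rw [dOf_bump z (show 6 ∈ range 7 by simp)]; omega
  have h77 : bump z 6 (6 + 1) ≤ bump z 6 0 := by rw [show (6 : ℕ) + 1 = 7 from rfl, hb77v, bump_zero]; omega
  obtain ⟨hb77, hs77⟩ := box_update (bump z 6) hb7 hd7 (show 6 ∈ range 7 by simp) h77
  have hK : InBox (hShift z) := inBox_hShift z hz
  have hdK : 0 ≤ dOf (hShift z) := by rw [dOf_hShift]; exact hd0
  have hNK : (hShift z 0).toNat = N + 1 := by rw [hShift_zero]; omega
  have hN7 : (bump z 6 0).toNat = N := by rw [bump_zero]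
  have hN77 : (bump (bump z 6) 6 0).toNat = N := by rw [bump_zero, bump_zero]
  -- degree of the telescoper (`d ≥ 1`)
  have hg : (raiseG z).natDegree + 1 ≤ 6 * (N + 1) := by
    have h1 := natDegree_raiseG_le z
    have hs : ((∑ j ∈ range 7, 2 * (z (j + 1)).toNat : ℕ) : ℤ) = 2 * ∑ j ∈ range 7, z (j + 1) := by
      push_cast
      rw [mul_sum]
      exact sum_congr rfl fun j hj => by rw [Int.toNat_of_nonneg (hz.2 j hj).1]
    unfold dOf at hd
    omega
  -- the numerator identity
  have e7 : numPoly (bump z 6) = numPoly z * ((X + C (z 7 : ℚ)) * (X + C ((z 0 - z 7 : ℤ) : ℚ))) :=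
    numPoly_update z (show 6 ∈ range 7 by simp) hz7
  have e77 : numPoly (bump (bump z 6) 6) =
      numPoly (bump z 6) * ((X + C (bump z 6 7 : ℚ)) * (X + C ((bump z 6 0 - bump z 6 7 : ℤ) : ℚ))) :=
    numPoly_update (bump z 6) (show 6 ∈ range 7 by simp) (by rw [show (6 : ℕ) + 1 = 7 from rfl, hb77v]; omega)
  have hrel : C (-raisePr z) * numPoly (hShift z) + C (raiseTh1 z) * (numPoly z * (X + C ((N + 1 : ℕ) : ℚ)) ^ 6) +
        C (raiseTh2 z) * (numPoly (bump z 6) * (X + C ((N + 1 : ℕ) : ℚ)) ^ 6) +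
        C (raiseTh3 z) * (numPoly (bump (bump z 6) 6) * (X + C ((N + 1 : ℕ) : ℚ)) ^ 6) =
      (raiseG z).comp (X + C 1) * X ^ 6 - raiseG z * (X + C ((N + 1 : ℕ) : ℚ)) ^ 6 := by
    rw [← sub_eq_zero]
    refine (mul_eq_zero.1 ?_).resolve_left (pcPoly_ne_zero z)
    apply Polynomial.funext
    intro x
    -- `Pc, PT, ∏(x+z_j), ∏(x+z₀+1−z_j), T₃, q, S_z(x), S_z(x+1), numPoly_{Hz}(x)` stay atoms: the combination is formal
    have hK' := eval_numPoly_hShift_mul z hz x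
    have hS := slotEval_shift_mul z hz x
    have hcore := raise_core z x
    have hT : t3Eval z (x + 1) * pcStar z x = nAll z x := by
      unfold t3Eval pcStar nAll; ring
    rw [e77, e7]
    simp only [eval_mul, eval_sub, eval_add, eval_pow, eval_comp, eval_C, eval_X, eval_zero, eval_pcPoly,
      hb77v, bump_zero]
    rw [eval_numPoly_slotEval z x, eval_raiseG z x, eval_raiseG_succ z x]
    push_cast
    rw [hNq]
    linear_combination (-raisePr z) * hK' + (-raiseQ z x) * hS + (-(x ^ 7 * raiseQ z x * slotEval z (x + 1))) * hT +
      (slotEval z x * (x + z 0 + 1) ^ 6) * hcore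
  have main := coeff_rel_of_summable_mixed13 (hShift z) z (bump z 6) (bump (bump z 6) 6) N hK hz hb7 hb77
    (sum_le_of_dOf _ hdK) (sum_le_of_dOf _ hd0) hs7 hs77 hNK rfl hN7 hN77
    (-raisePr z) (raiseTh1 z) (raiseTh2 z) (raiseTh3 z) (raiseG z) hg hrel
  obtain ⟨⟨hU, hW⟩, hV⟩ := main
  have hg1 : (raiseG z).eval 1 = 0 := by rw [eval_raiseG]; ring
  rw [hg1, zero_div] at hV
  exact ⟨⟨by linear_combination hU, by linear_combination hW⟩, by linear_combination hV⟩

end Summit.KontsevichZagierPeriods.Zeta5Search.Elimination
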